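import Mathlib
import Literature.LinearAlgebra.Matrix.RankMinors

/-!
# Generic rank: ranks of polynomial families do not drop at an algebraically independent point
# (crux `ValuativeGCT.ValuativeFlip`, stmt-ValiantsHypothesis-12624; wall-breaker axis k8 gen 1,
# "representation-stability transfer between sizes", seat 2)

Helper file (`--supports stmt-ValiantsHypothesis-12624`), line `four-row-count`.  The size transfer
`N ↦ N + 3` of the border ranks `r(N)` of the `m`-free heart of `stub_fourRowPencilRank` (see
`…PencilBorderChainSecond`) is run on the GENERIC pattern: a pattern whose entries are algebraically
independent over `ℤ`.  Its one engine is the SPECIALISATION PRINCIPLE proved here: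

* `gr_rank_map_le_of_injective` — for a matrix `M` over a commutative ring `R`, an injective ring map
  `φ : R → K` and any ring map `ψ : R → K'` into fields, `rank (M.map ψ) ≤ rank (M.map φ)`
  (a non-zero minor of `M.map ψ` is the image of a non-zero minor of `M`);
* `gr_finrank_span_map_le_of_injective` — the same for the span of a finite family of multivariate
  polynomials `F i ∈ R[X_τ]`: `finrank K' (span (map ψ ∘ F)) ≤ finrank K (span (map φ ∘ F))`;
* `gr_exists_algebraicIndependent_nat` — `ℂ` contains an algebraically independent sequence
  `x : ℕ → ℂ` over `ℤ` (a transcendence basis of `ℂ/ℤ` has cardinality `𝔠`), so that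
  `MvPolynomial.aeval x : ℤ[X_ℕ] → ℂ` is injective and every INTEGER specialisation of a universal
  family has rank at most the rank at `x`.

All statements are folklore linear algebra. [folklore; Literature/LinearAlgebra/Matrix/RankMinors]
-/

set_option linter.dupNamespace false

namespace Summit.ValiantsHypothesis.ValiantsHypothesis.Theorems.ValuativeFlip

open scoped BigOperators Matrix
open MvPolynomial

section Matrix

variable {R K K' : Type*} [CommRing R] [Field K] [Field K'] {m n : Type*} [Fintype m] [Fintype n]

/-- **Specialisation principle for matrix ranks.**  If `φ : R →+* K` is injective and `ψ : R →+* K'`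
is any ring map into a field, then `rank (M.map ψ) ≤ rank (M.map φ)`: a non-zero `s × s` minor of
`M.map ψ` is `ψ` of the corresponding minor of `M`, which is therefore non-zero, and stays non-zero
under the injective `φ`. [folklore] -/
theorem gr_rank_map_le_of_injective [DecidableEq m] [DecidableEq n] (M : Matrix m n R)
    (φ : R →+* K) (hφ : Function.Injective φ) (ψ : R →+* K') :
    (M.map ψ).rank ≤ (M.map φ).rank := by
  classical
  obtain ⟨r, c, -, -, hdet⟩ :=
    Literature.LinearAlgebra.Matrix.exists_det_submatrix_ne_zero_of_le_rank (M.map ψ) le_rfl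
  refine (Literature.LinearAlgebra.Matrix.le_rank_iff_exists_det_submatrix_ne_zero (M.map φ)).2
    ⟨r, c, ?_⟩
  have hR : (M.submatrix r c).det ≠ 0 := by
    intro h0
    apply hdet
    rw [Matrix.submatrix_map, ← RingHom.mapMatrix_apply, ← RingHom.map_det, h0, map_zero]
  rw [Matrix.submatrix_map, ← RingHom.mapMatrix_apply, ← RingHom.map_det]
  exact fun h => hR (hφ (by rw [h, map_zero]))

end Matrix

section Polynomials

variable {R K K' : Type*} [CommRing R] [Field K] [Field K'] {τ ι : Type*} [Fintype ι]

/-- The rows of the coefficient matrix of a linearly independent finite family of polynomials (columns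
indexed by any finite set of monomials containing all supports) are linearly independent. [folklore] -/
theorem gr_linearIndependent_coeffRows {κ : Type*} [Fintype κ] (G : κ → MvPolynomial τ K)
    (hG : LinearIndependent K G) (T : Finset (τ →₀ ℕ)) (hT : ∀ i, (G i).support ⊆ T) :
    LinearIndependent K (fun i : κ => fun t : T => coeff (t : τ →₀ ℕ) (G i)) := by
  classical
  rw [Fintype.linearIndependent_iff] at hG ⊢
  intro c hc i
  refine hG c ?_ i
  ext t
  rw [coeff_sum, coeff_zero]
  by_cases ht : t ∈ T
  · have := congrFun hc ⟨t, ht⟩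
    simpa [Finset.sum_apply, Pi.smul_apply, smul_eq_mul] using this
  · refine Finset.sum_eq_zero fun j _ => ?_
    rw [coeff_smul, smul_eq_mul]
    have : coeff t (G j) = 0 := by
      rw [← notMem_support_iff]
      exact fun h => ht (hT j h)
    rw [this, mul_zero]

/-- A family of polynomials whose coefficient rows (on a finite set of monomials) are linearly
independent is linearly independent. [folklore] -/
theorem gr_linearIndependent_of_coeffRows {κ : Type*} [Fintype κ] (G : κ → MvPolynomial τ K)
    (T : Finset (τ →₀ ℕ))
    (h : LinearIndependent K (fun i : κ => fun t : T => coeff (t : τ →₀ ℕ) (G i))) :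
    LinearIndependent K G := by
  classical
  rw [Fintype.linearIndependent_iff] at h ⊢
  intro c hc i
  refine h c ?_ i
  funext t
  have := congrArg (coeff (t : τ →₀ ℕ)) hc
  rw [coeff_sum, coeff_zero] at this
  simpa [Finset.sum_apply, Pi.smul_apply, smul_eq_mul, coeff_smul] using this

/-- **Specialisation principle for spans of polynomial families.**  For a finite family
`F i ∈ R[X_τ]`, an injective ring map `φ : R →+* K` and any ring map `ψ : R →+* K'` into fields, the
span of the `ψ`-specialised family has dimension at most that of the `φ`-specialised family:
`finrank K' (span (map ψ ∘ F)) ≤ finrank K (span (map φ ∘ F))`.  (Coefficient matrix over `R`,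
`gr_rank_map_le_of_injective`.) [folklore] -/
theorem gr_finrank_span_map_le_of_injective (F : ι → MvPolynomial τ R)
    (φ : R →+* K) (hφ : Function.Injective φ) (ψ : R →+* K') :
    Module.finrank K' ↥(Submodule.span K' (Set.range fun i => MvPolynomial.map ψ (F i))) ≤
      Module.finrank K ↥(Submodule.span K (Set.range fun i => MvPolynomial.map φ (F i))) := by
  classical
  obtain ⟨κ, a, ha, hspan, hli⟩ := exists_linearIndependent' K' (fun i => MvPolynomial.map ψ (F i))
  haveI : Fintype κ := Fintype.ofInjective a ha
  have hcard : Fintype.card κ =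
      Module.finrank K' ↥(Submodule.span K' (Set.range fun i => MvPolynomial.map ψ (F i))) := by
    rw [← hspan]
    exact (finrank_span_eq_card hli).symm
  -- coefficient matrix over `R` on the union of the supports
  let T : Finset (τ →₀ ℕ) := Finset.univ.biUnion fun i : κ => (F (a i)).support
  have hT : ∀ (f : R →+* K') (i : κ), (MvPolynomial.map f (F (a i))).support ⊆ T := by
    intro f i t ht
    exact Finset.mem_biUnion.2 ⟨i, Finset.mem_univ _, support_map_subset _ _ ht⟩
  have hTK : ∀ (i : κ), (MvPolynomial.map φ (F (a i))).support ⊆ T := by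
    intro i t ht
    exact Finset.mem_biUnion.2 ⟨i, Finset.mem_univ _, support_map_subset _ _ ht⟩
  let MR : Matrix κ T R := Matrix.of fun i t => coeff (t : τ →₀ ℕ) (F (a i))
  have hMψ : MR.map ψ = Matrix.of fun i (t : T) => coeff (t : τ →₀ ℕ) (MvPolynomial.map ψ (F (a i))) := by
    ext i t; simp [MR, coeff_map]
  have hMφ : MR.map φ = Matrix.of fun i (t : T) => coeff (t : τ →₀ ℕ) (MvPolynomial.map φ (F (a i))) := by
    ext i t; simp [MR, coeff_map]
  -- rank of the `ψ`-specialisation is `|κ|`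
  have hrows : LinearIndependent K' (fun i : κ => (MR.map ψ) i) := by
    rw [hMψ]
    exact gr_linearIndependent_coeffRows (fun i => MvPolynomial.map ψ (F (a i))) hli T (hT ψ)
  have hrankψ : (MR.map ψ).rank = Fintype.card κ := by
    rw [Matrix.rank_eq_finrank_span_row]
    exact finrank_span_eq_card hrows
  -- hence `|κ| ≤ rank (MR.map φ)`, giving `|κ|` independent rows of the `φ`-specialisation
  have hle : Fintype.card κ ≤ (MR.map φ).rank := hrankψ ▸ gr_rank_map_le_of_injective MR φ hφ ψ
  rw [← Matrix.rank_transpose] at hle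
  obtain ⟨r, hr, hrli⟩ :=
    Literature.LinearAlgebra.Matrix.exists_linearIndependent_cols_of_le_rank (MR.map φ)ᵀ hle
  have hrli' : LinearIndependent K (fun j : Fin (Fintype.card κ) => fun t : T =>
      coeff (t : τ →₀ ℕ) (MvPolynomial.map φ (F (a (r j))))) := by
    convert hrli using 1
    funext j
    ext t
    simp [hMφ]
  have hG : LinearIndependent K (fun j : Fin (Fintype.card κ) => MvPolynomial.map φ (F (a (r j)))) :=
    gr_linearIndependent_of_coeffRows _ T hrli'
  -- conclude
  haveI : Module.Finite K ↥(Submodule.span K (Set.range fun i => MvPolynomial.map φ (F i))) :=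
    Module.Finite.span_of_finite K (Set.finite_range _)
  rw [← hcard]
  calc Fintype.card κ = Fintype.card (Fin (Fintype.card κ)) := (Fintype.card_fin _).symm
    _ = Module.finrank K ↥(Submodule.span K
          (Set.range fun j : Fin (Fintype.card κ) => MvPolynomial.map φ (F (a (r j))))) :=
        (finrank_span_eq_card hG).symm
    _ ≤ Module.finrank K ↥(Submodule.span K (Set.range fun i => MvPolynomial.map φ (F i))) := by
        apply Submodule.finrank_mono
        apply Submodule.span_mono
        rintro _ ⟨j, rfl⟩
        exact ⟨a (r j), rfl⟩


/-- **Initial forms: the rank of a one-parameter polynomial family dominates the rank of its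
lowest-order terms.**  Let `R` be a domain, `e ∈ R` non-zero, `θ : R →+* R` a ring map killing `e`
("set `e := 0`"), and `G i = e^{d i} · (H i + e · K i)` a finite family of polynomials over `R` whose
lowest-order parts `H i` are `e`-free (`map θ (H i) = H i`).  Then under any injective ring map
`φ : R →+* F` into a field, `finrank (span (φH)) ≤ finrank (span (φG))`: a non-singular coefficient
minor `D` of `H` gives the coefficient minor `e^{Σ d} · det (A + e B)` of `G` on the same rows and
monomials, and `θ (det (A + e B)) = D ≠ 0`. [folklore] -/
theorem gr_finrank_span_map_initial_le {F : Type*} [Field F] [IsDomain R] (φ : R →+* F)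
    (hφ : Function.Injective φ) (e : R) (he : e ≠ 0) (θ : R →+* R) (hθe : θ e = 0) (d : ι → ℕ)
    (H K₁ G : ι → MvPolynomial τ R) (hH : ∀ i, MvPolynomial.map θ (H i) = H i)
    (hG : ∀ i, G i = C (e ^ d i) * (H i + C e * K₁ i)) :
    Module.finrank F ↥(Submodule.span F (Set.range fun i => MvPolynomial.map φ (H i))) ≤
      Module.finrank F ↥(Submodule.span F (Set.range fun i => MvPolynomial.map φ (G i))) := by
  classical
  obtain ⟨κ, a, ha, hspan, hli⟩ := exists_linearIndependent' F (fun i => MvPolynomial.map φ (H i))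
  haveI : Fintype κ := Fintype.ofInjective a ha
  have hcard : Fintype.card κ =
      Module.finrank F ↥(Submodule.span F (Set.range fun i => MvPolynomial.map φ (H i))) := by
    rw [← hspan]
    exact (finrank_span_eq_card hli).symm
  -- a non-singular coefficient minor of `φH ∘ a`
  let T : Finset (τ →₀ ℕ) := Finset.univ.biUnion fun i : κ => (H (a i)).support ∪ (G (a i)).support
  have hTH : ∀ i : κ, (MvPolynomial.map φ (H (a i))).support ⊆ T := fun i t ht =>
    Finset.mem_biUnion.2 ⟨i, Finset.mem_univ _, Finset.mem_union_left _ (support_map_subset _ _ ht)⟩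
  have hTG : ∀ i : κ, (MvPolynomial.map φ (G (a i))).support ⊆ T := fun i t ht =>
    Finset.mem_biUnion.2 ⟨i, Finset.mem_univ _, Finset.mem_union_right _ (support_map_subset _ _ ht)⟩
  let N : Matrix κ T F := Matrix.of fun i (t : T) => coeff (t : τ →₀ ℕ) (MvPolynomial.map φ (H (a i)))
  have hNrows : LinearIndependent F (fun i : κ => N i) :=
    gr_linearIndependent_coeffRows (fun i => MvPolynomial.map φ (H (a i))) hli T hTH
  have hNrank : Fintype.card κ ≤ N.rank := by
    rw [Matrix.rank_eq_finrank_span_row]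
    exact (finrank_span_eq_card hNrows).ge
  obtain ⟨r, c, hr, -, hdet⟩ :=
    Literature.LinearAlgebra.Matrix.exists_det_submatrix_ne_zero_of_le_rank N hNrank
  -- the same minor over `R`, for `H` and for `G`
  let A : Matrix (Fin (Fintype.card κ)) (Fin (Fintype.card κ)) R :=
    Matrix.of fun i j => coeff ((c j : T) : τ →₀ ℕ) (H (a (r i)))
  let B : Matrix (Fin (Fintype.card κ)) (Fin (Fintype.card κ)) R :=
    Matrix.of fun i j => coeff ((c j : T) : τ →₀ ℕ) (K₁ (a (r i)))
  have hAφ : A.map φ = N.submatrix r c := by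
    ext i j
    simp [A, N, coeff_map]
  have hAdet : A.det ≠ 0 := by
    intro h0
    apply hdet
    rw [← hAφ, ← RingHom.mapMatrix_apply, ← RingHom.map_det, h0, map_zero]
  have hθA : A.map θ = A := by
    ext i j
    simp only [A, Matrix.map_apply, Matrix.of_apply]
    rw [← coeff_map, hH]
  have hABdet : (A + e • B).det ≠ 0 := by
    intro h0
    apply hAdet
    have h1 : θ (A + e • B).det = A.det := by
      rw [RingHom.map_det, RingHom.mapMatrix_apply]
      have : (A + e • B).map θ = A := by
        ext i j
        simp only [Matrix.map_apply, Matrix.add_apply, Matrix.smul_apply, smul_eq_mul, map_add,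
          map_mul, hθe, zero_mul, add_zero]
        exact congrFun (congrFun hθA i) j
      rw [this]
    rw [← h1, h0, map_zero]
  -- the coefficient minor of `G` on rows `a ∘ r` and monomials `c`
  let AG : Matrix (Fin (Fintype.card κ)) (Fin (Fintype.card κ)) R :=
    Matrix.of fun i j => coeff ((c j : T) : τ →₀ ℕ) (G (a (r i)))
  have hAG : AG = Matrix.of (fun i j => e ^ d (a (r i)) * (A + e • B) i j) := by
    ext i j
    simp only [AG, A, B, Matrix.of_apply, Matrix.add_apply, Matrix.smul_apply, smul_eq_mul, hG,
      coeff_C_mul, coeff_add]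
  have hAGdet : AG.det ≠ 0 := by
    rw [hAG]
    have : (Matrix.of fun i j => e ^ d (a (r i)) * (A + e • B) i j) =
        Matrix.diagonal (fun i => e ^ d (a (r i))) * (A + e • B) := by
      ext i j
      simp [Matrix.diagonal_mul]
    rw [this, Matrix.det_mul, Matrix.det_diagonal]
    exact mul_ne_zero (Finset.prod_ne_zero_iff.2 fun i _ => pow_ne_zero _ he) hABdet
  have hAGφ : (AG.map φ).det ≠ 0 := by
    rw [← RingHom.mapMatrix_apply, ← RingHom.map_det]
    exact fun h => hAGdet (hφ (by rw [h, map_zero]))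
  -- hence the rows `φG ∘ a ∘ r` are linearly independent
  have hGrows : LinearIndependent F (fun i : Fin (Fintype.card κ) => fun t : T =>
      coeff (t : τ →₀ ℕ) (MvPolynomial.map φ (G (a (r i))))) := by
    rw [Fintype.linearIndependent_iff]
    intro w hw
    have hvec : w ᵥ* (AG.map φ) = 0 := by
      funext j
      have := congrFun hw (c j)
      simp only [Finset.sum_apply, Pi.smul_apply, smul_eq_mul, Pi.zero_apply] at this
      simp only [Matrix.vecMul, dotProduct, Matrix.map_apply, AG, Matrix.of_apply, Pi.zero_apply]
      simpa [coeff_map] using this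
    exact congrFun (Matrix.eq_zero_of_vecMul_eq_zero hAGφ hvec)
  have hGli : LinearIndependent F (fun i : Fin (Fintype.card κ) => MvPolynomial.map φ (G (a (r i)))) :=
    gr_linearIndependent_of_coeffRows _ T hGrows
  haveI : Module.Finite F ↥(Submodule.span F (Set.range fun i => MvPolynomial.map φ (G i))) :=
    Module.Finite.span_of_finite F (Set.finite_range _)
  rw [← hcard]
  calc Fintype.card κ = Fintype.card (Fin (Fintype.card κ)) := (Fintype.card_fin _).symm
    _ = Module.finrank F ↥(Submodule.span F
          (Set.range fun j : Fin (Fintype.card κ) => MvPolynomial.map φ (G (a (r j))))) :=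
        (finrank_span_eq_card hGli).symm
    _ ≤ Module.finrank F ↥(Submodule.span F (Set.range fun i => MvPolynomial.map φ (G i))) := by
        apply Submodule.finrank_mono
        apply Submodule.span_mono
        rintro _ ⟨j, rfl⟩
        exact ⟨a (r j), rfl⟩

end Polynomials

section Transcendental

open Cardinal in
/-- `ℂ` contains a sequence `x : ℕ → ℂ` that is algebraically independent over `ℤ` (a transcendence
basis of `ℂ` over `ℤ` has cardinality `𝔠 ≥ ℵ₀`). [folklore] -/
theorem gr_exists_algebraicIndependent_nat : ∃ x : ℕ → ℂ, AlgebraicIndependent ℤ x := by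
  obtain ⟨s, hv⟩ := exists_isTranscendenceBasis ℤ ℂ
  have hcard : #ℂ = #s :=
    IsAlgClosed.cardinal_eq_cardinal_transcendence_basis_of_aleph0_lt' ((↑) : s → ℂ) hv (by simp)
      (by rw [Cardinal.mk_complex]; exact Cardinal.aleph0_lt_continuum)
  have hinf : Infinite s := by
    rw [Cardinal.infinite_iff, ← hcard, Cardinal.mk_complex]
    exact Cardinal.aleph0_lt_continuum.le
  exact ⟨((↑) : s → ℂ) ∘ Infinite.natEmbedding s, hv.1.comp _ (Infinite.natEmbedding s).injective⟩

/-- The evaluation at an algebraically independent sequence is an injective ring map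
`ℤ[X_ℕ] → ℂ` (restatement of `algebraicIndependent_iff_injective_aeval` for ring maps). [folklore] -/
theorem gr_aeval_injective {ι : Type*} (x : ι → ℂ) (hx : AlgebraicIndependent ℤ x) :
    Function.Injective ((MvPolynomial.aeval x : MvPolynomial ι ℤ →ₐ[ℤ] ℂ) : MvPolynomial ι ℤ →+* ℂ) :=
  fun _ _ h => algebraicIndependent_iff_injective_aeval.1 hx h

/-- **Generic rank dominates every specialisation.**  For a finite family of polynomials
`F i ∈ ℤ[X_ι][X_τ]` with integer-polynomial coefficients in parameters `X_ι`, an algebraically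
independent point `x : ι → ℂ` and ANY point `y : ι → ℂ`, the span of the family specialised at `y`
has dimension at most that of the family specialised at `x`. [folklore] -/
theorem gr_finrank_span_aeval_le {ι κ τ : Type*} [Fintype κ] (F : κ → MvPolynomial τ (MvPolynomial ι ℤ)) (x : ι → ℂ) (hx : AlgebraicIndependent ℤ x) (y : ι → ℂ) : Module.finrank ℂ ↥(Submodule.span ℂ (Set.range fun i => MvPolynomial.map ((MvPolynomial.aeval y : MvPolynomial ι ℤ →ₐ[ℤ] ℂ) : MvPolynomial ι ℤ →+* ℂ) (F i))) ≤ Module.finrank ℂ ↥(Submodule.span ℂ (Set.range fun i => MvPolynomial.map ((MvPolynomial.aeval x : MvPolynomial ι ℤ →ₐ[ℤ] ℂ) : MvPolynomial ι ℤ →+* ℂ) (F i))) :=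
  gr_finrank_span_map_le_of_injective F _ (gr_aeval_injective x hx) _

end Transcendental

end Summit.ValiantsHypothesis.ValiantsHypothesis.Theorems.ValuativeFlip
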